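import Mathlib
import Summits.ValiantsHypothesis.ValiantsHypothesis.Theorems.DissociatedFixedK.Negative.LoadBearing
import Summits.ValiantsHypothesis.ValiantsHypothesis.Theorems.NewtonUnitEquationsDissociatedFixedKSweep

/-!
# `DissociatedFixedK` (stmt-ValiantsHypothesis-5907), line `annihilator-product-functional` —
registered stub `stub_topTupleCount` (blueprint step 4: the box tops are few)

For letter sets `S j ⊆ ℕ²` (`j < m`) with `#S j ≤ t`, the tuples `b ∈ Π_j S j` that are, for SOME
continuous linear functional `l` on `ℝ²`, coordinatewise maximal for the lexicographic key
`e ↦ (l (emb e), e 0, e 1)` number at most `4 (m t)² + 7`.  Proof: such a `b` is the tuple of `lexTop`s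
of `l` (`eq_lexTop_of_forall_le`: the key `lexKey` is injective); the `lexTop` of a letter set depends on
`l` only through the comparison pattern of `l` on the `≤ m t` points `P = emb (⋃_j S j)`
(`lexTop_eq_of_cmpPat_eq`), so the tuple of tops takes at most as many values as there are patterns,
`≤ 4|P|² + 7` (`ncard_range_topTuple_le`, from the landed `ncard_range_cmpPat_le` =
`stub_cmpPatCount`, file `…DissociatedFixedKSweep.lean`).  The statement is `k`-free and
polynomial-free; in the line's assembly it is applied to the alive boxes `C I j ⊆ A j`.
`emb e = fun i => ((e i : ℕ) : ℝ)` is the landed `Negative.LoadBearing.emb` (p74111).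
Ported verbatim from the checked kit (`Disproof.lean` v3 §E4) and `FullProof-…lean` §S. [folklore]
-/

namespace Summit.ValiantsHypothesis.Theorems.DissociatedFixedK

open scoped BigOperators Classical
open Finset
open Summit.ValiantsHypothesis.ValiantsHypothesis.Theorems.DissociatedFixedK.Negative (emb emb_injective)

noncomputable section

/-! ## §E4  The lexicographic top of a letter set and its invariance under equal comparison patterns -/

section LexTop

/-- Sort key of an exponent under the functional `l`: its `l`-value, ties broken by the exponent itself
(lexicographically on its two coordinates).  Values in the linear order `ℝ ×ₗ (ℕ ×ₗ ℕ)`. -/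
noncomputable def lexKey (l : (Fin 2 → ℝ) →L[ℝ] ℝ) (q : Fin 2 →₀ ℕ) : Lex (ℝ × Lex (ℕ × ℕ)) :=
  toLex (l (emb q), toLex (q 0, q 1))

/-- The sort key is injective (the tie-break is the exponent itself). -/
theorem lexKey_injective (l : (Fin 2 → ℝ) →L[ℝ] ℝ) : Function.Injective (lexKey l) := by
  intro q q' h
  have h2 : (toLex (q 0, q 1) : Lex (ℕ × ℕ)) = toLex (q' 0, q' 1) := congrArg Prod.snd (toLex.injective h)
  have h3 : (q 0, q 1) = (q' 0, q' 1) := toLex.injective h2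
  ext i
  fin_cases i
  · exact congrArg Prod.fst h3
  · exact congrArg Prod.snd h3

/-- The `l`-top letter of a nonempty letter set `C` (ties broken by `lexKey`). -/
noncomputable def lexTop (l : (Fin 2 → ℝ) →L[ℝ] ℝ) (C : Finset (Fin 2 →₀ ℕ)) (hC : C.Nonempty) :
    Fin 2 →₀ ℕ :=
  (Finset.exists_max_image C (lexKey l) hC).choose

/-- The top letter belongs to the letter set. -/
theorem lexTop_mem (l : (Fin 2 → ℝ) →L[ℝ] ℝ) (C : Finset (Fin 2 →₀ ℕ)) (hC : C.Nonempty) :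
    lexTop l C hC ∈ C :=
  (Finset.exists_max_image C (lexKey l) hC).choose_spec.1

/-- The top letter is `lexKey`-maximal. -/
theorem lexKey_le_lexTop (l : (Fin 2 → ℝ) →L[ℝ] ℝ) (C : Finset (Fin 2 →₀ ℕ)) (hC : C.Nonempty)
    {q : Fin 2 →₀ ℕ} (hq : q ∈ C) : lexKey l q ≤ lexKey l (lexTop l C hC) :=
  (Finset.exists_max_image C (lexKey l) hC).choose_spec.2 q hq

/-- Uniqueness: any `lexKey`-maximal letter of `C` is the top. -/
theorem eq_lexTop_of_forall_le (l : (Fin 2 → ℝ) →L[ℝ] ℝ) (C : Finset (Fin 2 →₀ ℕ)) (hC : C.Nonempty)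
    {q : Fin 2 →₀ ℕ} (hq : q ∈ C) (hmax : ∀ q' ∈ C, lexKey l q' ≤ lexKey l q) :
    q = lexTop l C hC :=
  lexKey_injective l (le_antisymm (lexKey_le_lexTop l C hC hq) (hmax _ (lexTop_mem l C hC)))

/-- **Invariance.** Two functionals that compare the letters of `C` identically have the same top. -/
theorem lexTop_eq_of_cmp_iff (l l' : (Fin 2 → ℝ) →L[ℝ] ℝ) (C : Finset (Fin 2 →₀ ℕ)) (hC : C.Nonempty)
    (H : ∀ p ∈ C, ∀ q ∈ C, (l (emb p) < l (emb q) ↔ l' (emb p) < l' (emb q))) :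
    lexTop l C hC = lexTop l' C hC := by
  apply eq_lexTop_of_forall_le l' C hC (lexTop_mem l C hC)
  intro q hq
  have h := lexKey_le_lexTop l C hC hq
  simp only [lexKey, Prod.Lex.le_iff] at h ⊢
  rcases h with h | ⟨h1, h2⟩
  · exact Or.inl ((H q hq _ (lexTop_mem l C hC)).mp h)
  · right
    refine ⟨?_, h2⟩
    have h1' : l (emb q) = l (emb (lexTop l C hC)) := h1
    have a : ¬ l' (emb q) < l' (emb (lexTop l C hC)) := fun h' => by
      have := (H q hq _ (lexTop_mem l C hC)).mpr h'
      rw [h1'] at this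
      exact lt_irrefl _ this
    have b : ¬ l' (emb (lexTop l C hC)) < l' (emb q) := fun h' => by
      have := (H _ (lexTop_mem l C hC) q hq).mpr h'
      rw [h1'] at this
      exact lt_irrefl _ this
    exact le_antisymm (not_lt.mp b) (not_lt.mp a)

/-- The same, from equality of comparison patterns on any finite `P ⊇ emb '' C` (so, with §E3:
for fixed `C` — and for a fixed tuple of letter sets — the top (tuple) takes `≤ 4|P|² + 7` values as `l`
ranges over all functionals). -/
theorem lexTop_eq_of_cmpPat_eq (P : Finset (Fin 2 → ℝ)) (l l' : (Fin 2 → ℝ) →L[ℝ] ℝ)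
    (hpat : cmpPat P l = cmpPat P l') (C : Finset (Fin 2 →₀ ℕ)) (hC : C.Nonempty)
    (hCP : ∀ q ∈ C, emb q ∈ P) : lexTop l C hC = lexTop l' C hC := by
  apply lexTop_eq_of_cmp_iff
  intro p hp q hq
  have := congrFun hpat (⟨emb p, hCP p hp⟩, ⟨emb q, hCP q hq⟩)
  simpa [cmpPat] using this

/-- Counting form used in blueprint step 4: for a tuple of nonempty letter sets inside `P`, the tuple of
tops, as a function of the functional, factors through `cmpPat P`; hence its range has
`≤ 4|P|² + 7` elements. -/
theorem ncard_range_topTuple_le {m : ℕ} (P : Finset (Fin 2 → ℝ)) (C : Fin m → Finset (Fin 2 →₀ ℕ))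
    (hC : ∀ j, (C j).Nonempty) (hCP : ∀ j, ∀ q ∈ C j, emb q ∈ P) :
    (Set.range (fun l : (Fin 2 → ℝ) →L[ℝ] ℝ => fun j => lexTop l (C j) (hC j))).ncard
      ≤ 4 * (P.card * P.card) + 7 := by
  classical
  set tt := (fun l : (Fin 2 → ℝ) →L[ℝ] ℝ => fun j => lexTop l (C j) (hC j)) with htt
  -- tt factors through cmpPat P
  have hfac : ∀ l l', cmpPat P l = cmpPat P l' → tt l = tt l' := by
    intro l l' h
    funext j
    exact lexTop_eq_of_cmpPat_eq P l l' h (C j) (hC j) (hCP j)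
  -- so range tt is the image of range (cmpPat P) under a function
  have hchoose : ∀ c ∈ Set.range (cmpPat P), ∃ l, cmpPat P l = c := fun c hc => hc
  choose fn hfn using hchoose
  let Φ : (↥P × ↥P → Bool) → (Fin m → (Fin 2 →₀ ℕ)) := fun c =>
    if hc : c ∈ Set.range (cmpPat P) then tt (fn c hc) else fun j => lexTop 0 (C j) (hC j)
  have hsub : Set.range tt ⊆ Φ '' Set.range (cmpPat P) := by
    rintro _ ⟨l, rfl⟩
    refine ⟨cmpPat P l, ⟨l, rfl⟩, ?_⟩
    have hc : cmpPat P l ∈ Set.range (cmpPat P) := ⟨l, rfl⟩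
    simp only [Φ, dif_pos hc]
    exact hfac _ _ (hfn _ hc)
  calc (Set.range tt).ncard ≤ (Φ '' Set.range (cmpPat P)).ncard :=
        Set.ncard_le_ncard hsub (Set.toFinite _)
    _ ≤ (Set.range (cmpPat P)).ncard := Set.ncard_image_le (Set.toFinite _)
    _ ≤ 4 * (P.card * P.card) + 7 := ncard_range_cmpPat_le P

end LexTop

/-- **stub_topTupleCount** (registered stub of crux stmt-ValiantsHypothesis-5907, line
`annihilator-product-functional`): for letter sets `S j` with `#S j ≤ t`, the tuples of `Π_j S j` that are
coordinatewise lex-key-maximal for SOME continuous linear functional number `≤ 4 (m t)² + 7`.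
[folklore] -/
theorem stub_topTupleCount (m t : ℕ) (S : Fin m → Finset (Fin 2 →₀ ℕ)) (hS : ∀ j, (S j).card ≤ t) :
    ((Fintype.piFinset S).filter fun b : Fin m → (Fin 2 →₀ ℕ) =>
        ∃ l : (Fin 2 → ℝ) →L[ℝ] ℝ, ∀ j, ∀ e ∈ S j,
          (toLex (l (fun i : Fin 2 => ((e i : ℕ) : ℝ)), toLex (e 0, e 1)) : Lex (ℝ × Lex (ℕ × ℕ)))
            ≤ toLex (l (fun i : Fin 2 => (((b j) i : ℕ) : ℝ)), toLex ((b j) 0, (b j) 1))).card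
      ≤ 4 * (m * t) ^ 2 + 7 := by
  classical
  by_cases hne : ∀ j, (S j).Nonempty
  · set P : Finset (Fin 2 → ℝ) := (Finset.univ.biUnion S).image emb with hP
    have hPcard : P.card ≤ m * t := by
      calc P.card ≤ (Finset.univ.biUnion S).card := Finset.card_image_le
        _ ≤ ∑ j, (S j).card := Finset.card_biUnion_le
        _ ≤ ∑ _j : Fin m, t := Finset.sum_le_sum fun j _ => hS j
        _ = m * t := by simp
    have hCP : ∀ j, ∀ q ∈ S j, emb q ∈ P := fun j q hq =>
      Finset.mem_image.2 ⟨q, Finset.mem_biUnion.2 ⟨j, Finset.mem_univ _, hq⟩, rfl⟩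
    have hsub : (↑((Fintype.piFinset S).filter fun b : Fin m → (Fin 2 →₀ ℕ) =>
        ∃ l : (Fin 2 → ℝ) →L[ℝ] ℝ, ∀ j, ∀ e ∈ S j,
          (toLex (l (fun i : Fin 2 => ((e i : ℕ) : ℝ)), toLex (e 0, e 1)) : Lex (ℝ × Lex (ℕ × ℕ)))
            ≤ toLex (l (fun i : Fin 2 => (((b j) i : ℕ) : ℝ)), toLex ((b j) 0, (b j) 1))) :
          Set (Fin m → (Fin 2 →₀ ℕ)))
        ⊆ Set.range (fun l : (Fin 2 → ℝ) →L[ℝ] ℝ => fun j => lexTop l (S j) (hne j)) := by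
      intro b hb
      rw [Finset.mem_coe, Finset.mem_filter] at hb
      obtain ⟨hbS, l, hl⟩ := hb
      refine ⟨l, ?_⟩
      funext j
      exact (eq_lexTop_of_forall_le l (S j) (hne j) (Fintype.mem_piFinset.1 hbS j)
        (fun q hq => hl j q hq)).symm
    have hfinR : (Set.range (fun l : (Fin 2 → ℝ) →L[ℝ] ℝ => fun j => lexTop l (S j) (hne j))).Finite := by
      refine (Finset.finite_toSet (Fintype.piFinset S)).subset ?_
      rintro _ ⟨l, rfl⟩
      exact Finset.mem_coe.2 (Fintype.mem_piFinset.2 fun j => lexTop_mem l (S j) (hne j))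
    have hsq : P.card * P.card ≤ m * t * (m * t) := Nat.mul_le_mul hPcard hPcard
    calc ((Fintype.piFinset S).filter fun b : Fin m → (Fin 2 →₀ ℕ) =>
          ∃ l : (Fin 2 → ℝ) →L[ℝ] ℝ, ∀ j, ∀ e ∈ S j,
            (toLex (l (fun i : Fin 2 => ((e i : ℕ) : ℝ)), toLex (e 0, e 1)) : Lex (ℝ × Lex (ℕ × ℕ)))
              ≤ toLex (l (fun i : Fin 2 => (((b j) i : ℕ) : ℝ)), toLex ((b j) 0, (b j) 1))).card
        = (↑((Fintype.piFinset S).filter fun b : Fin m → (Fin 2 →₀ ℕ) =>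
          ∃ l : (Fin 2 → ℝ) →L[ℝ] ℝ, ∀ j, ∀ e ∈ S j,
            (toLex (l (fun i : Fin 2 => ((e i : ℕ) : ℝ)), toLex (e 0, e 1)) : Lex (ℝ × Lex (ℕ × ℕ)))
              ≤ toLex (l (fun i : Fin 2 => (((b j) i : ℕ) : ℝ)), toLex ((b j) 0, (b j) 1))) :
            Set (Fin m → (Fin 2 →₀ ℕ))).ncard := (Set.ncard_coe_finset _).symm
      _ ≤ (Set.range (fun l : (Fin 2 → ℝ) →L[ℝ] ℝ => fun j => lexTop l (S j) (hne j))).ncard :=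
          Set.ncard_le_ncard hsub hfinR
      _ ≤ 4 * (P.card * P.card) + 7 := ncard_range_topTuple_le P S hne hCP
      _ ≤ 4 * (m * t) ^ 2 + 7 := by rw [sq]; omega
  · push Not at hne
    obtain ⟨j, hj⟩ := hne
    have hempty : Fintype.piFinset S = ∅ :=
      Fintype.piFinset_eq_empty.2 ⟨j, hj⟩
    rw [hempty]
    simp

end

end Summit.ValiantsHypothesis.Theorems.DissociatedFixedK
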